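import Summits.ResolutionOfSingularities.ResolutionOfSingularities.Theorems.FrobeniusLadderFRationalResolutionResolutionLocal
import Summits.ResolutionOfSingularities.ResolutionOfSingularities.Theorems.FrobeniusLadderFRationalResolutionSurfaceSingularLocus
import Summits.ResolutionOfSingularities.ResolutionOfSingularities.Theorems.FrobeniusLadderFRationalResolutionTowerStep
import Literature.AlgebraicGeometry.Resolution.CanonicalResolutionProofs
import HarnessLib

/-!
# The crux in dimension 2 is LOCAL: F-rational surfaces are resolved by local resolutions of
# their finitely many singular points

Support file for crux stmt-ResolutionOfSingularities-15317 (`FrobeniusLadder.FRationalResolution`),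
line `Sketch`, continuation seat c3, wave 4, theme (L). An integral F-rational surface `X/k`
(finite type, `dim X ≤ 2`, stalks satisfying the crux's F-rational clause) has finitely many
singular points, all closed (c1, `finite_compl_regularLocus_of_fRational_surface`), and its regular
locus is open (fields are J-2, `isOpen_regularLocus_of_locallyOfFiniteType_field`) and dense (it
contains the generic point). So by the local-to-global gluing `stub_hasResolution_of_local_resolutions`
(wave 4, L2): **if every singular point `s` has an open neighbourhood `V` (meeting no other singular
point) with a LOCAL resolution — a proper `ρ : Y → V`, `Y` regular, an isomorphism over `V ∩ Reg X`
with dense preimage — then `X` has a resolution of singularities.** In dimension 2 the crux (and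
the `redirect` line's punctual engine `stub_isolatedFRegularization`) is therefore a statement about
single F-rational surface GERM NEIGHBOURHOODS; the `A_n` tower (`hasResolution_An`) is the model
case of such a local resolution. [folklore; Lipman 1978 §2 for the strategy]
-/

-- single-problem summit: the doubled namespace component is forced
set_option linter.dupNamespace false

noncomputable section

namespace Summit.ResolutionOfSingularities.ResolutionOfSingularities.Theorems.FRationalResolution

open CategoryTheory AlgebraicGeometry TopologicalSpace
open Literature.AlgebraicGeometry.Resolution

/-- **THE CRUX IN DIMENSION 2 IS LOCAL.** For an integral `k`-scheme `X` of finite type over a field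
`k` of characteristic `p`, of dimension `≤ 2`, whose stalks satisfy the F-rational clause of
`FRationalResolution`: if every singular point `s ∉ Reg X` has an open neighbourhood `V ∋ s`
containing no other singular point and a proper `ρ : Y → V` from a regular scheme which is an
isomorphism over `V ∩ Reg X` with dense preimage, then `X` has a resolution of singularities.
(`Reg X` is open, dense, and its complement is a finite set of closed points; glue the local
resolutions one point at a time, `stub_hasResolution_of_local_resolutions`.) [folklore] -/
theorem hasResolution_fRational_surface_of_local (p : ℕ) (hp : p.Prime) (k : Type) [Field k]
    [CharP k p] (X : Scheme.{0}) [IsIntegral X] (f : X ⟶ Spec (.of k)) [LocallyOfFiniteType f]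
    [QuasiCompact f]
    (hFR : ∀ x : X, IsDomain (X.presheaf.stalk x) ∧ ∀ d : ℕ, ringKrullDim (X.presheaf.stalk x) = d →
      ∀ s : Fin d → X.presheaf.stalk x, (Ideal.span (Set.range s)).radical.IsMaximal →
      ∀ y c : X.presheaf.stalk x, c ≠ 0 →
      (∀ e : ℕ, c * y ^ p ^ e ∈ Ideal.span ((fun z : X.presheaf.stalk x => z ^ p ^ e) ''
        (Ideal.span (Set.range s) : Set (X.presheaf.stalk x)))) → y ∈ Ideal.span (Set.range s))
    (hdim : topologicalKrullDim X ≤ 2)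
    (hloc : ∀ s : X, s ∉ Scheme.regularLocus X → ∃ (V : X.Opens), s ∈ V ∧
      (∀ t : X, t ∉ Scheme.regularLocus X → t ∈ V → t = s) ∧
      ∃ (Y : Scheme.{0}) (ρ : Y ⟶ V), IsProper ρ ∧ Scheme.IsRegular Y ∧
        IsIso (ρ ∣_ (V.ι ⁻¹ᵁ ⟨Scheme.regularLocus X, isOpen_regularLocus_of_locallyOfFiniteType_field f⟩)) ∧
        Dense ((ρ ⁻¹ᵁ (V.ι ⁻¹ᵁ ⟨Scheme.regularLocus X,
          isOpen_regularLocus_of_locallyOfFiniteType_field f⟩) : Y.Opens) : Set Y)) :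
    Scheme.HasResolution X := by
  classical
  haveI : IsNoetherian X := Scheme.isNoetherian_of_finiteType_over_field f
  -- the open regular locus `U`
  set U : X.Opens := ⟨Scheme.regularLocus X, isOpen_regularLocus_of_locallyOfFiniteType_field f⟩
    with hU
  have hmemU : ∀ x : X, x ∈ U ↔ IsRegularLocalRing (X.presheaf.stalk x) := fun x => Iff.rfl
  -- `U` is a regular scheme
  have hUreg : Scheme.IsRegular (U : Scheme.{0}) :=
    isRegular_opens_of_stalk U fun x hx => (hmemU x).mp hx
  -- the finitely many singular points
  have hfin : (Scheme.regularLocus X)ᶜ.Finite :=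
    finite_compl_regularLocus_of_fRational_surface p hp k X f hFR hdim
  set S : Finset X := hfin.toFinset with hS
  have hmemS : ∀ x : X, x ∈ S ↔ x ∉ Scheme.regularLocus X := fun x => by
    rw [hS, Set.Finite.mem_toFinset]; rfl
  have hcov : ∀ x : X, x ∈ U ∨ x ∈ S := fun x => by
    by_cases hx : x ∈ Scheme.regularLocus X
    · exact Or.inl hx
    · exact Or.inr ((hmemS x).mpr hx)
  -- local resolutions, repackaged over `S`
  have hloc' : ∀ s ∈ S, ∃ (V : X.Opens), s ∈ V ∧ (∀ t ∈ S, t ∈ V → t = s) ∧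
      ∃ (Y : Scheme.{0}) (ρ : Y ⟶ V), IsProper ρ ∧ Scheme.IsRegular Y ∧
        IsIso (ρ ∣_ (V.ι ⁻¹ᵁ U)) ∧ Dense ((ρ ⁻¹ᵁ (V.ι ⁻¹ᵁ U) : Y.Opens) : Set Y) := by
    intro s hs
    obtain ⟨V, hsV, hVS, Y, ρ, hρ, hY, hiso, hd⟩ := hloc s ((hmemS s).mp hs)
    exact ⟨V, hsV, fun t ht htV => hVS t ((hmemS t).mp ht) htV, Y, ρ, hρ, hY, hiso, hd⟩
  obtain ⟨X', π, hπ, hX'reg, hiso, hd⟩ :=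
    stub_hasResolution_of_local_resolutions X U hUreg S hcov hloc'
  -- `U` is dense: it contains the generic point
  have hN : ∀ x : X, IsIntegrallyClosed (X.presheaf.stalk x) :=
    isIntegrallyClosed_stalk_of_fRational_clause p hp k X f hFR
  have hgen : genericPoint X ∈ U := by
    refine mem_regularLocus_of_ringKrullDim_stalk_le_one hN ?_
    have h0 : ringKrullDim (X.presheaf.stalk (genericPoint X)) = 0 :=
      ringKrullDim_eq_zero_of_field X.functionField
    rw [h0]; exact zero_le_one
  have hUd : Dense (U : Set X) :=
    U.2.dense ⟨genericPoint X, hgen⟩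
  haveI := hπ
  exact ⟨X', π, ⟨inferInstance, ⟨U, hUd, hd, hiso⟩, hX'reg⟩⟩

end Summit.ResolutionOfSingularities.ResolutionOfSingularities.Theorems.FRationalResolution

end
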